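import Mathlib.Algebra.BigOperators.Group.Finset.Basic
import Mathlib.Algebra.Order.BigOperators.Group.Finset
import Mathlib.Tactic
import HarnessLib

/-!
# K7 — THE POINT-CHAIN CAP `ord N ≤ 8`: slack domination along chains of point blow-ups

[OURS · L1 W4.5a · res-L1-w45a-lead-1 g14 · kernel brick K7 for crux `FInjectiveMacaulayfication` stmt-ResolutionOfSingularities-15315; companion of
`Cruxes/FInjectiveMacaulayfication/Lines/T-disc.md` §0.5♯/§0.5♮; supports the crux, proves nothing of it; OURS counted 0; AI-written (AI review is weaker than expert review).]

WHY. By the discriminant master formula (K6, `T-disc.md`), at the j-th point `x_j` of a chain of point blow-ups over a FULL triple point the datum is read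
off the support `S` of `Disc_x(P₃)`: `ω_j = min_S order_j`, `α_E = min_S level_E`, `ord N_j = ω_j − Σ_{E ∋ x_j} α_E`, budget `Bud_j = 8 + 2Σ_{E∋x_j} c_E`.
With the SLACK `σ_j := Bud_j − ω_j` (so `σ_j ≥ 0` at a drop point, by the log-canonical budget) one has the exact identities
`2c_E − α_E = σ(centre E)` and `ord N_j = 8 − σ_j + Σ_{E∋x_j} σ(centre E)`, and the pointwise recursions
`σ_j(γ) = 2σ_{j−1}(γ) + γ_L` (direction an original letter L) / `σ_j(γ) = 2σ_{j−1}(γ) − σ_m(γ)` (direction the exceptional letter with centre `x_m`),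
whence `σ_j ≥ 2σ_{j−1}` resp. `σ_j ≥ 2σ_{j−1} − σ_m⁺`, while the set `I_j` of centres of the divisors through `x_j` becomes `I_{j−1} ∪ {j−1}` resp.
`(I_{j−1} ∖ {m}) ∪ {j−1}`. This file proves, for ANY such abstract chain,
* ★★ `slack_domination`: `Σ_{i ∈ I_j} σ_i⁺ ≤ σ_j⁺` for every j (induction on j);
* ★★ `pointChain_ordN_le_eight`: at a point with `σ_j ≥ 0` (a drop point), `8 − σ_j + Σ_{i∈I_j} σ_i ≤ 8`, i.e. **`ord N ≤ 8` at every drop point of every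
  chain of point blow-ups, at every depth and for every prime** — so no wild point (`ord N ≥ p`) on point chains for `p ≥ 11` (indeed `p ≥ 9`).
No named fact; finite sums and linear arithmetic. The geometric inputs (master formula, level rule, budget) are in `T-disc.md`; this is their arithmetic shadow.
-/

-- single-problem summit: the doubled namespace component is forced
set_option linter.dupNamespace false

open Finset

namespace Summit.ResolutionOfSingularities.ResolutionOfSingularities.Theorems.FInjectiveMacaulayfication.FullPointChainCap

section Chain

/- The STEP RULE of an abstract chain of point blow-ups seen through the slacks: `σ j` is the budget slack at the j-th point, `I j` the set of
indices of the centres of the exceptional divisors through it; each step either keeps all divisors (direction an original letter: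
`σ (j+1) ≥ 2σ j`) or drops the divisor with centre `m` whose letter is the direction (`σ (j+1) ≥ 2σ j − (σ m)⁺`), and always adds the new
divisor with centre `j`. -/
variable (σ : ℕ → ℤ) (I : ℕ → Finset ℕ) (h0 : I 0 = ∅)
  (hstep : ∀ j, (I (j + 1) = insert j (I j) ∧ 2 * σ j ≤ σ (j + 1)) ∨
    (∃ m ∈ I j, I (j + 1) = insert j ((I j).erase m) ∧ 2 * σ j - max (σ m) 0 ≤ σ (j + 1)))
include h0 hstep

/-- Every centre index through the j-th point is `< j`. [plumbing] -/
theorem mem_I_lt : ∀ j, ∀ i ∈ I j, i < j := by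
  intro j
  induction j with
  | zero => intro i hi; simp [h0] at hi
  | succ j ih =>
    intro i hi
    rcases hstep j with ⟨hI, -⟩ | ⟨m, -, hI, -⟩
    · rw [hI, mem_insert] at hi
      rcases hi with rfl | hi
      · exact Nat.lt_succ_self _
      · exact Nat.lt_succ_of_lt (ih i hi)
    · rw [hI, mem_insert] at hi
      rcases hi with rfl | hi
      · exact Nat.lt_succ_self _
      · exact Nat.lt_succ_of_lt (ih i (mem_of_mem_erase hi))

/-- `j ∉ I j`. [plumbing] -/
theorem not_mem_I_self (j : ℕ) : j ∉ I j := fun h => lt_irrefl j (mem_I_lt σ I h0 hstep j j h)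

/-- ★★ SLACK DOMINATION: the positive parts of the slacks at the centres of the divisors through the j-th point sum to at most the positive
part of the slack at that point. [OURS] -/
theorem slack_domination : ∀ j, ∑ i ∈ I j, max (σ i) 0 ≤ max (σ j) 0 := by
  intro j
  induction j with
  | zero => simp [h0]
  | succ j ih =>
    have hj : j ∉ I j := not_mem_I_self σ I h0 hstep j
    rcases hstep j with ⟨hI, hrec⟩ | ⟨m, hm, hI, hrec⟩
    · -- original direction: I (j+1) = insert j (I j), σ (j+1) ≥ 2 σ j
      rw [hI, sum_insert hj]
      have h1 : max (σ j) 0 + ∑ i ∈ I j, max (σ i) 0 ≤ max (σ j) 0 + max (σ j) 0 := by linarith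
      refine le_trans h1 ?_
      rcases le_or_gt (σ j) 0 with h | h
      · rw [max_eq_right h]; simp
      · rw [max_eq_left h.le]
        have : 2 * σ j ≤ max (σ (j + 1)) 0 := le_trans hrec (le_max_left _ _)
        linarith
    · -- exceptional direction with centre m ∈ I j: I (j+1) = insert j ((I j).erase m), σ (j+1) ≥ 2σ j − (σ m)⁺
      have hj' : j ∉ (I j).erase m := fun h => hj (mem_of_mem_erase h)
      rw [hI, sum_insert hj']
      have hsplit : max (σ m) 0 + ∑ i ∈ (I j).erase m, max (σ i) 0 = ∑ i ∈ I j, max (σ i) 0 :=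
        add_sum_erase (I j) (fun i => max (σ i) 0) hm
      have h1 : max (σ j) 0 + ∑ i ∈ (I j).erase m, max (σ i) 0
          ≤ max (σ j) 0 + max (σ j) 0 - max (σ m) 0 := by linarith
      refine le_trans h1 ?_
      have hm0 : 0 ≤ max (σ m) 0 := le_max_right _ _
      rcases le_or_gt (σ j) 0 with h | h
      · rw [max_eq_right h]
        have : 0 ≤ max (σ (j + 1)) 0 := le_max_right _ _
        linarith
      · rw [max_eq_left h.le]
        have : 2 * σ j - max (σ m) 0 ≤ max (σ (j + 1)) 0 := le_trans hrec (le_max_left _ _)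
        linarith

/-- ★★ THE POINT-CHAIN CAP. At a point of the chain whose slack is non-negative (the log-canonical budget at a drop point), the residual order
`ord N = 8 − σ_j + Σ_{i ∈ I_j} σ_i` (slack identity of `T-disc.md` §0.5♯) is at most `8`. Hence no wild point (`ord N ≥ p`) at any drop point of
any chain of point blow-ups over a FULL triple point with `x³` in its cone, for every prime `p ≥ 9`. [OURS] -/
theorem pointChain_ordN_le_eight (j : ℕ) (hσ : 0 ≤ σ j) : 8 - σ j + ∑ i ∈ I j, σ i ≤ 8 := by
  have h1 : ∑ i ∈ I j, σ i ≤ ∑ i ∈ I j, max (σ i) 0 := sum_le_sum fun i _ => le_max_left _ _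
  have h2 := slack_domination σ I h0 hstep j
  rw [max_eq_left hσ] at h2
  linarith

/-- The same in the form `ord N < p` for `p ≥ 9`. [OURS] -/
theorem pointChain_not_wild (p : ℤ) (hp : 9 ≤ p) (j : ℕ) (hσ : 0 ≤ σ j) : 8 - σ j + ∑ i ∈ I j, σ i < p :=
  lt_of_le_of_lt (pointChain_ordN_le_eight σ I h0 hstep j hσ) (by linarith)

end Chain


section GeneralCentres

/- K7♭ (appended): ARBITRARY CENTRES. For a chain of point blow-ups whose next centre is ANY closed point of the new exceptional divisor
(letter direction or not), the set `Left j ⊆ I j` of divisors whose strict transforms miss the new point may have any size; intrinsically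
(`T-disc.md` §0.13): `ω_{j+1} ≤ 2ω_j − 6 − Σ_{E ∈ Left} α_E`, `Bud_{j+1} = 2Bud_j − 6 − 2Σ_{Left} d_E`, `2d_E − α_E = σ(centre E)`, hence
`σ (j+1) ≥ 2σ j − Σ_{m ∈ Left j} σ m ≥ 2σ j − Σ_{m ∈ Left j} (σ m)⁺` and `I (j+1) = insert j (I j \ Left j)`. -/
variable (σ : ℕ → ℤ) (I Left : ℕ → Finset ℕ) (h0 : I 0 = ∅)
  (hsub : ∀ j, Left j ⊆ I j)
  (hI : ∀ j, I (j + 1) = insert j (I j \ Left j))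
  (hrec : ∀ j, 2 * σ j - ∑ m ∈ Left j, max (σ m) 0 ≤ σ (j + 1))
include h0 hsub hI hrec

omit hsub hrec in
/-- Every centre index through the j-th point is `< j` (arbitrary-centre version). [plumbing] -/
theorem mem_I_lt' : ∀ j, ∀ i ∈ I j, i < j := by
  intro j
  induction j with
  | zero => intro i hi; simp [h0] at hi
  | succ j ih =>
    intro i hi
    rw [hI, mem_insert] at hi
    rcases hi with rfl | hi
    · exact Nat.lt_succ_self _
    · exact Nat.lt_succ_of_lt (ih i (mem_sdiff.mp hi).1)

/-- ★★ SLACK DOMINATION FOR ARBITRARY POINT CENTRES: `Σ_{i ∈ I_j} σ_i⁺ ≤ σ_j⁺`, when each step may drop any subset `Left j` of the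
divisors through the point (several exceptional divisors left at once = a non-letter direction). Same induction as `slack_domination`.
[OURS] -/
theorem slack_domination_subset : ∀ j, ∑ i ∈ I j, max (σ i) 0 ≤ max (σ j) 0 := by
  intro j
  induction j with
  | zero => simp [h0]
  | succ j ih =>
    have hj : j ∉ I j := fun h => lt_irrefl j (mem_I_lt' I Left h0 hI j j h)
    have hj' : j ∉ I j \ Left j := fun h => hj (mem_sdiff.mp h).1
    rw [hI, sum_insert hj']
    -- Σ_{I j \ Left j} σ⁺ = Σ_{I j} σ⁺ − Σ_{Left j} σ⁺
    have hsplit : ∑ i ∈ I j \ Left j, max (σ i) 0 + ∑ i ∈ Left j, max (σ i) 0 = ∑ i ∈ I j, max (σ i) 0 :=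
      sum_sdiff (hsub j)
    have hL0 : 0 ≤ ∑ i ∈ Left j, max (σ i) 0 := sum_nonneg fun i _ => le_max_right _ _
    have h1 : max (σ j) 0 + ∑ i ∈ I j \ Left j, max (σ i) 0
        ≤ max (σ j) 0 + max (σ j) 0 - ∑ i ∈ Left j, max (σ i) 0 := by linarith
    refine le_trans h1 ?_
    have hr := hrec j
    rcases le_or_gt (σ j) 0 with h | h
    · rw [max_eq_right h]
      have : 0 ≤ max (σ (j + 1)) 0 := le_max_right _ _
      linarith
    · rw [max_eq_left h.le]
      have : 2 * σ j - ∑ m ∈ Left j, max (σ m) 0 ≤ max (σ (j + 1)) 0 := le_trans hr (le_max_left _ _)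
      linarith

/-- ★★ THE POINT-CHAIN CAP FOR ARBITRARY CENTRES: at a point with non-negative slack, `8 − σ_j + Σ_{i∈I_j} σ_i ≤ 8` — `ord N ≤ 8` at every drop point
of every chain of point blow-ups with arbitrary closed-point centres over a FULL triple point with `x³` in its cone ((Q-flag) included). [OURS] -/
theorem pointChain_ordN_le_eight_subset (j : ℕ) (hσ : 0 ≤ σ j) : 8 - σ j + ∑ i ∈ I j, σ i ≤ 8 := by
  have h1 : ∑ i ∈ I j, σ i ≤ ∑ i ∈ I j, max (σ i) 0 := sum_le_sum fun i _ => le_max_left _ _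
  have h2 := slack_domination_subset σ I Left h0 hsub hI hrec j
  rw [max_eq_left hσ] at h2
  linarith

end GeneralCentres

end Summit.ResolutionOfSingularities.ResolutionOfSingularities.Theorems.FInjectiveMacaulayfication.FullPointChainCap
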